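import Mathlib.Analysis.Complex.Basic
import Mathlib.LinearAlgebra.Finsupp.LinearCombination
import Mathlib.LinearAlgebra.Finsupp.Supported
import Mathlib.LinearAlgebra.Dual.Defs
import Mathlib.Topology.Algebra.FilterBasis
import Mathlib.Topology.Algebra.Nonarchimedean.Basic
import Mathlib.Topology.Algebra.OpenSubgroup
import Mathlib.LinearAlgebra.FiniteDimensional.Defs
import Mathlib.Analysis.SpecificLimits.Basic
import Mathlib.MeasureTheory.Integral.Lebesgue.Countable
import Literature.NumberTheory.Automorphic.MatrixCoefficients
import HarnessLib

/-!
# "Discrete series are tempered" fails without local compactness: a counterexample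

The named fact `Representation.IsDiscreteSeries.isTempered` of
`Literature.NumberTheory.Automorphic.MatrixCoefficients` reads, *as elaborated*,

  `∀ {G V} [Group G] [TopologicalSpace G] [NonarchimedeanGroup G] [AddCommGroup V] [Module ℂ V]`
  `[MeasurableSpace (G ⧸ Z(G))] {ρ : Representation ℂ G V} {μ}, ρ.IsAdmissible →`
  `ρ.IsDiscreteSeries μ → ρ.IsTempered μ` :

the section binders `[LocallyCompactSpace G] [T2Space G]` under which it was written do not
occur in its body and are therefore not among its hypotheses (this is documented on
`Representation.IsDiscreteSeries.isTempered_of_locallyCompactSpace`, the corrected statement,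
which *is* a theorem: `Representation.IsDiscreteSeries.isTempered_of_locallyCompactSpace_holds`
in `Literature.NumberTheory.Automorphic.MatrixCoefficientsTemperedProofs`). This file shows
that the hypothesis cannot be dropped: it constructs a nonarchimedean (Hausdorff, not locally
compact) topological group `Gp`, a smooth **admissible, unitarizable** representation `rho` of
`Gp` on `V = ℂ^(ℤ)` and a measure `mu` on `Gp ⧸ Z(Gp)` such that `rho` is square-integrable
modulo the centre in the domination form (`rho.IsDiscreteSeries mu`) but **not** tempered
(`¬ rho.IsTempered mu`), whence

* `Literature.NumberTheory.Automorphic.TemperedCounterexample.not_isTempered_Gp :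
    ¬ Representation.IsDiscreteSeries.isTempered (G := Gp) (V := V)`,
* `Representation.IsDiscreteSeries.not_forall_isTempered` — the universal closure of the named
  fact over all nonarchimedean groups is false (a deliberate dot-notation extension of the
  Mathlib namespace `Representation`, placed next to the refuted fact).

Since the verdict clean-up of 2026-08-15 the refuted constant
`Representation.IsDiscreteSeries.isTempered` is `@[deprecated]` in `MatrixCoefficients.lean`
(kept there, verbatim, only because the two theorems above name it; it is no longer a named fact
awaiting discharge). The two refuting theorems therefore name a deprecated constant on purpose and
are each preceded by `set_option linter.deprecated false in`; nothing else in this file uses it.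

In print the implication "discrete series ⟹ tempered" (Getz–Hahn, Definition 4.6;
Cowling–Haagerup–Howe, §1: `L²` versus "almost `L²`" matrix coefficients) concerns unitary
representations of locally compact groups, whose matrix coefficients are *bounded*; in the
smooth algebraic setting of `MatrixCoefficients.lean` boundedness comes from admissibility
through a compact open subgroup (`Ṽ^K = (V^K)^*`). Without a compact open subgroup a smooth
linear form on a unitarizable admissible representation need not be bounded, and the mechanism
below produces smooth coefficients of *exact* exponential growth, uniformly over the smooth
contragredient, which separates `L²`-domination from `L^{2+ε}`-domination for a suitable atomic
measure.

## Construction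

* `V = ℤ →₀ ℂ` with basis `e k = Finsupp.single k 1` and the standard Hermitian form
  `form x y = ∑ₖ conj (x k) * y k` (conjugate-linear in the first variable).
* `phi0 : Module.Dual ℂ V`, the `form`-unbounded linear form `e k ↦ weight k` (`= 2 ^ k` for
  `k ≥ 0`, `0` for `k < 0`), and the space of linear forms
  `FF = ℂ ∙ phi0 ⊔ span {coordinate forms δ_k^*}`.
* `Gp`, the group of all `form`-unitary linear automorphisms `u` of `V` such that `η ∘ u` and
  `η ∘ u⁻¹` lie in `FF` for all `η ∈ FF` (a subgroup of `V ≃ₗ[ℂ] V`). It contains the shift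
  `shift : e k ↦ e (k + 1)` (`phi0 ∘ shift = 2 phi0 + δ_{-1}^*`) and every unitary reflection
  `refl m : x ↦ x - (2 ⟨m, x⟩ / ⟨m, m⟩) m` (`η ∘ refl m = η - c ⟨m, ·⟩`).
* The subgroups `U i = {u ∈ Gp | u (e k) = e k for |k| < i, phi0 ∘ u = phi0}`, `i : ℕ`, form a
  `GroupFilterBasis` (`basis`; the conjugation axiom uses unitarity and the shape of `FF`),
  whence a group topology on `Gp`, nonarchimedean with the `U i` as basic open subgroups
  (`instNonarchimedeanGroup`). It is the topology of pointwise convergence for the action of `Gp`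
  on the discrete set `V ⊔ FF`.
* `rho`, the tautological representation of `Gp` on `V`; `mu = ∑ₙ 8⁻ⁿ δ_{shift ^ n · Z(Gp)}` on
  `Gp ⧸ Z(Gp)` (all subsets measurable).

## Main statements

* `isSmooth_rho`, `isUnitarizable_rho` (`form` is invariant), `isAdmissible_rho`: for every open
  subgroup `H ⊇ U j` the `H`-fixed vectors are supported on `[-j, j)`
  (`finite_fixedPoints_of_isOpen`; the reflections in `e k`, `k < -j`, and in
  `mvec k = e (k+1) - 2 e k`, `k ≥ j`, lie in `U j`), so admissibility holds genuinely although no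
  open subgroup of `Gp` is compact.
* `exists_eq_smul_of_mem_center`: central elements act by unitary scalars (commute with the
  reflection in `e (-1)` and with the shift), so `|c_{φ,v}|` is constant on cosets of `Z(Gp)`.
* `exists_U_invariant`, `apply_e_succ`, `apply_iterate_shift`: a smooth linear form `φ` is
  `U j`-invariant for some `j`, hence kills `mvec k` for `k ≥ j`, i.e. `φ (e (k+1)) = 2 φ (e k)`,
  and therefore `φ (shift^n x) = 2 ^ n φ x` for `x` supported on `[j, ∞)`;
  `exists_norm_apply_iterate_shift_le`: `‖φ (shift^n v)‖ ≤ 2 ^ n A_{φ,v}` for all smooth `φ`,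
  all `v`, all `n`.
* `isSquareIntegrableModCenter_rho` (`∑ₙ 8⁻ⁿ (2ⁿA)² = 2A² < ∞`), `isDiscreteSeries_rho`,
  `not_isTempered_rho` (`phi0 (shift^n (e 0)) = 2ⁿ` and `∑ₙ 8⁻ⁿ 16ⁿ = ∞`, so no `L⁴(mu)`
  dominator exists: `ε = 2`), `not_isTempered_Gp`,
  `Representation.IsDiscreteSeries.not_forall_isTempered`.

## Design notes

All instances declared here (`GroupFilterBasis`, `TopologicalSpace`, `IsTopologicalGroup`,
`NonarchimedeanGroup`, `MeasurableSpace := ⊤`, `DiscreteMeasurableSpace`) live on the new type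
`↥Gp` (and the `DiscreteMeasurableSpace` instance on its quotient by the centre, whose
`MeasurableSpace` structure is Mathlib's `QuotientGroup.measurableSpace`); none overrides a
Mathlib instance. Everything is elementary linear algebra and carries `[folklore]` tags; the
sources below are those of the refuted/corrected fact.

## References

* J. R. Getz, H. Hahn, *An introduction to automorphic representations, with a view toward trace
  formulae*, GTM 300, Springer (2024), §4.8, Definition 4.6.
* M. Cowling, U. Haagerup, R. Howe, *Almost `L²` matrix coefficients*, J. reine angew. Math. 387
  (1988), 97–110, §1.
-/

open scoped ComplexConjugate
open Finsupp

namespace Literature.NumberTheory.Automorphic.TemperedCounterexample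

/-- The underlying space `V = ℂ^(ℤ)`: finitely supported functions `ℤ → ℂ`. [folklore] -/
abbrev V : Type := ℤ →₀ ℂ

/-- The standard basis vector `e k = δ_k` of `V = ℂ^(ℤ)`. [folklore] -/
noncomputable abbrev e (k : ℤ) : V := Finsupp.single k 1

/-! ### The standard Hermitian form -/

/-- The standard positive-definite Hermitian form `form x y = ∑ₖ conj (x k) * y k` on `ℂ^(ℤ)`,
conjugate-linear in the first variable (Mathlib's inner-product convention). [folklore] -/
noncomputable def form : V →ₗ⋆[ℂ] V →ₗ[ℂ] ℂ :=
  LinearMap.mk₂'ₛₗ (starRingEnd ℂ) (RingHom.id ℂ) (fun x y => x.sum fun k a => conj a * y k)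
    (fun x₁ x₂ y => by
      rw [Finsupp.sum_add_index'] <;> simp [add_mul])
    (fun c x y => by
      rw [Finsupp.sum_smul_index' (fun k => by simp)]
      simp only [smul_eq_mul, map_mul, Finsupp.sum, Finset.mul_sum, mul_assoc])
    (fun x y₁ y₂ => by
      simp only [Finsupp.add_apply, mul_add, Finsupp.sum, Finset.sum_add_distrib])
    (fun c x y => by
      simp only [Finsupp.smul_apply, smul_eq_mul, RingHom.id_apply, Finsupp.sum, Finset.mul_sum,
        mul_left_comm])

/-- Unfolding lemma for `form`. [folklore] -/
lemma form_apply (x y : V) : form x y = x.sum fun k a => conj a * y k := rfl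

/-- `form (e k · a) y = conj a * y k`. [folklore] -/
@[simp] lemma form_single_left (k : ℤ) (a : ℂ) (y : V) :
    form (Finsupp.single k a) y = conj a * y k := by
  rw [form_apply, Finsupp.sum_single_index]
  simp

/-- `form` is Hermitian: `conj (form x y) = form y x`. [folklore] -/
lemma form_conj_symm (x y : V) : conj (form x y) = form y x := by
  induction x using Finsupp.induction_linear with
  | zero => simp
  | add x₁ x₂ h₁ h₂ => simp [h₁, h₂]
  | single k a =>
    induction y using Finsupp.induction_linear with
    | zero => simp
    | add y₁ y₂ h₁ h₂ =>
      rw [map_add, map_add, h₁, h₂, LinearMap.map_add₂]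
    | single j b =>
      rw [form_single_left, form_single_left, Finsupp.single_apply, Finsupp.single_apply]
      by_cases h : k = j
      · subst h; simp [mul_comm]
      · rw [if_neg (Ne.symm h), if_neg h, mul_zero, mul_zero, map_zero]

/-- `form x (e k · a) = conj (x k) * a`. [folklore] -/
@[simp] lemma form_single_right (x : V) (k : ℤ) (a : ℂ) :
    form x (Finsupp.single k a) = conj (x k) * a := by
  rw [← form_conj_symm, form_single_left, map_mul, Complex.conj_conj, mul_comm]

/-- `form x x = ∑ₖ |x k|²` (as a complex number). [folklore] -/
lemma form_self (x : V) : form x x = ((x.sum fun _ a => Complex.normSq a : ℝ) : ℂ) := by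
  rw [form_apply, Finsupp.sum, Finsupp.sum, Complex.ofReal_sum]
  refine Finset.sum_congr rfl fun k _ => ?_
  rw [Complex.normSq_eq_conj_mul_self]

/-- `form x x` has non-negative real part. [folklore] -/
lemma form_self_re_nonneg (x : V) : 0 ≤ (form x x).re := by
  rw [form_self, Complex.ofReal_re]
  exact Finset.sum_nonneg fun k _ => Complex.normSq_nonneg _

/-- `form` is positive definite: `0 < re (form x x)` for `x ≠ 0`. [folklore] -/
lemma form_self_re_pos {x : V} (hx : x ≠ 0) : 0 < (form x x).re := by
  rw [form_self, Complex.ofReal_re]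
  obtain ⟨k, hk⟩ := Finsupp.support_nonempty_iff.2 hx
  refine lt_of_lt_of_le ?_ (Finset.single_le_sum (fun j _ => Complex.normSq_nonneg (x j)) hk)
  exact Complex.normSq_pos.2 (Finsupp.mem_support_iff.1 hk)

/-- `form x x = 0` only for `x = 0`. [folklore] -/
lemma form_self_eq_zero {x : V} (h : form x x = 0) : x = 0 := by
  by_contra hx
  have := form_self_re_pos hx
  rw [h, Complex.zero_re] at this
  exact lt_irrefl _ this

/-- `form x x` is real: `conj (form x x) = form x x`. [folklore] -/
lemma conj_form_self (x : V) : conj (form x x) = form x x := form_conj_symm x x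

/-- The linear form `form m = ⟨m, ·⟩` is the finite combination `∑ₖ conj (m k) • δ_k^*` of
coordinate forms. [folklore] -/
lemma form_eq_sum_lapply (m : V) :
    form m = m.sum fun k a => conj a • (Finsupp.lapply k : V →ₗ[ℂ] ℂ) := by
  ext j
  simp only [LinearMap.coe_comp, Function.comp_apply, Finsupp.lsingle_apply, form_single_right,
    mul_one, Finsupp.sum, LinearMap.coe_sum, Finset.sum_apply, LinearMap.smul_apply,
    Finsupp.lapply_apply, smul_eq_mul]
  rw [Finset.sum_eq_single j]
  · simp
  · intro k _ hkj
    rw [Finsupp.single_apply, if_neg (Ne.symm hkj), mul_zero]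
  · intro hj
    rw [Finsupp.notMem_support_iff.1 hj, map_zero, zero_mul]

/-! ### The unbounded linear form `phi0` and the space of linear forms `FF` -/

/-- The weights `2 ^ k` for `k ≥ 0` and `0` for `k < 0`. [folklore] -/
noncomputable def weight (k : ℤ) : ℂ := if 0 ≤ k then 2 ^ k.toNat else 0

/-- `weight n = 2 ^ n` for `n : ℕ`. [folklore] -/
@[simp] lemma weight_natCast (n : ℕ) : weight n = 2 ^ n := by
  simp [weight]

/-- `weight k = 0` for `k < 0`. [folklore] -/
lemma weight_of_neg {k : ℤ} (hk : k < 0) : weight k = 0 := by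
  simp [weight, not_le.2 hk]

/-- `weight (k + 1) = 2 * weight k` for `k ≥ 0`. [folklore] -/
lemma weight_add_one {k : ℤ} (hk : 0 ≤ k) : weight (k + 1) = 2 * weight k := by
  obtain ⟨n, rfl⟩ := Int.eq_ofNat_of_zero_le hk
  have : ((n : ℤ) + 1) = ((n + 1 : ℕ) : ℤ) := by push_cast; ring
  rw [this, weight_natCast, weight_natCast, pow_succ, mul_comm]

/-- The linear form `phi0 : e k ↦ weight k` (`= 2 ^ k` for `k ≥ 0`, `0` for `k < 0`); it is
unbounded for `form` along the orthonormal vectors `e k`. [folklore] -/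
noncomputable def phi0 : Module.Dual ℂ V := Finsupp.linearCombination ℂ weight

/-- `phi0 (e k · a) = a * weight k`. [folklore] -/
@[simp] lemma phi0_single (k : ℤ) (a : ℂ) : phi0 (Finsupp.single k a) = a * weight k := by
  simp [phi0, Finsupp.linearCombination_single]

/-- The space of linear forms `FF = ℂ ∙ phi0 ⊔ span {δ_k^*}`: scalar multiples of `phi0` plus
finitely supported linear forms. [folklore] -/
noncomputable def FF : Submodule ℂ (Module.Dual ℂ V) :=
  (ℂ ∙ phi0) ⊔ Submodule.span ℂ (Set.range fun k : ℤ => (Finsupp.lapply k : V →ₗ[ℂ] ℂ))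

/-- `phi0 ∈ FF`. [folklore] -/
lemma phi0_mem_FF : phi0 ∈ FF :=
  Submodule.mem_sup_left (Submodule.mem_span_singleton_self _)

/-- Coordinate forms lie in `FF`. [folklore] -/
lemma lapply_mem_FF (k : ℤ) : (Finsupp.lapply k : V →ₗ[ℂ] ℂ) ∈ FF :=
  Submodule.mem_sup_right (Submodule.subset_span ⟨k, rfl⟩)

/-- The forms `⟨m, ·⟩`, `m ∈ V`, lie in `FF`. [folklore] -/
lemma form_mem_FF (m : V) : form m ∈ FF := by
  rw [form_eq_sum_lapply]
  exact Submodule.finsuppSum_mem ℂ FF m _ fun k _ => FF.smul_mem _ (lapply_mem_FF k)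

/-- Elements of `FF` decompose as `c • phi0 + ∑ₖ d k • δ_k^*` with `d` finitely supported.
[folklore] -/
lemma exists_of_mem_FF {ψ : Module.Dual ℂ V} (hψ : ψ ∈ FF) :
    ∃ (c : ℂ) (d : ℤ →₀ ℂ), ψ = c • phi0 + d.sum fun k a => a • (Finsupp.lapply k : V →ₗ[ℂ] ℂ) := by
  obtain ⟨y, hy, z, hz, rfl⟩ := Submodule.mem_sup.1 hψ
  obtain ⟨c, rfl⟩ := Submodule.mem_span_singleton.1 hy
  obtain ⟨d, rfl⟩ := Finsupp.mem_span_range_iff_exists_finsupp.1 hz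
  exact ⟨c, d, rfl⟩

/-! ### Unitary reflections -/

/-- The reflection `x ↦ x - (2 ⟨m, x⟩ / ⟨m, m⟩) • m` in the hyperplane orthogonal to `m`, as a
linear map. [folklore] -/
noncomputable def reflLin (m : V) : V →ₗ[ℂ] V :=
  LinearMap.id - ((2 : ℂ) / form m m) • ((LinearMap.toSpanSingleton ℂ V m).comp (form m))

/-- Pointwise formula for `reflLin`. [folklore] -/
lemma reflLin_apply (m x : V) : reflLin m x = x - ((2 : ℂ) / form m m * form m x) • m := by
  simp [reflLin, mul_smul]

/-- A reflection negates its defining vector. [folklore] -/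
lemma reflLin_self {m : V} (hm : form m m ≠ 0) : reflLin m m = -m := by
  rw [reflLin_apply, div_mul_cancel₀ _ hm, two_smul]; abel

/-- A reflection fixes the vectors orthogonal to its defining vector. [folklore] -/
lemma reflLin_of_form_eq_zero {m x : V} (h : form m x = 0) : reflLin m x = x := by
  rw [reflLin_apply, h, mul_zero, zero_smul, sub_zero]

/-- A reflection is an involution. [folklore] -/
lemma reflLin_reflLin {m : V} (hm : form m m ≠ 0) (x : V) : reflLin m (reflLin m x) = x := by
  rw [reflLin_apply, reflLin_apply, map_sub, map_smul, smul_eq_mul]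
  have h2 : (2 : ℂ) / form m m * (form m x - 2 / form m m * form m x * form m m) =
      -(2 / form m m * form m x) := by
    field_simp; ring
  rw [h2, neg_smul, sub_neg_eq_add, sub_add_cancel]

/-- A reflection preserves the Hermitian form. [folklore] -/
lemma form_reflLin {m : V} (hm : form m m ≠ 0) (x y : V) :
    form (reflLin m x) (reflLin m y) = form x y := by
  rw [reflLin_apply, reflLin_apply]
  have hc : conj ((2 : ℂ) / form m m) = 2 / form m m := by
    rw [map_div₀, conj_form_self, map_ofNat]
  have hmx : form x m = conj (form m x) := (form_conj_symm m x).symm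
  simp only [map_sub, map_smulₛₗ, RingHom.id_apply, LinearMap.sub_apply, LinearMap.smul_apply,
    smul_eq_mul, map_mul, hc, hmx]
  field_simp
  ring

/-- Precomposition of a linear form with a reflection:
`η ∘ reflLin m = η - (2 η(m) / ⟨m,m⟩) • ⟨m, ·⟩`. [folklore] -/
lemma comp_reflLin (m : V) (η : Module.Dual ℂ V) :
    η ∘ₗ reflLin m = η - ((2 : ℂ) / form m m * η m) • form m := by
  ext x
  simp only [LinearMap.coe_comp, Function.comp_apply, reflLin_apply, map_sub, map_smul,
    smul_eq_mul, LinearMap.sub_apply, LinearMap.smul_apply]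
  ring

/-- The reflection in `m` (`⟨m, m⟩ ≠ 0`) as a linear automorphism of `V`. [folklore] -/
noncomputable def reflEquiv (m : V) (hm : form m m ≠ 0) : V ≃ₗ[ℂ] V :=
  LinearEquiv.ofInvolutive (reflLin m) (reflLin_reflLin hm)

/-- `reflEquiv` acts as `reflLin`. [folklore] -/
@[simp] lemma reflEquiv_apply (m : V) (hm : form m m ≠ 0) (x : V) :
    reflEquiv m hm x = reflLin m x := rfl

/-- `reflEquiv` is its own inverse. [folklore] -/
@[simp] lemma reflEquiv_symm_apply (m : V) (hm : form m m ≠ 0) (x : V) :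
    (reflEquiv m hm).symm x = reflLin m x := by
  rw [LinearEquiv.symm_apply_eq, reflEquiv_apply, reflLin_reflLin hm]

/-! ### The shift -/

/-- The shift `e k ↦ e (k + 1)` as a linear automorphism of `V`. [folklore] -/
noncomputable def shift : V ≃ₗ[ℂ] V := Finsupp.domLCongr (Equiv.addRight (1 : ℤ))

/-- The shift on basis vectors. [folklore] -/
@[simp] lemma shift_single (k : ℤ) (a : ℂ) :
    shift (Finsupp.single k a) = Finsupp.single (k + 1) a := by
  simp [shift, Finsupp.domLCongr_apply]

/-- The inverse shift on basis vectors. [folklore] -/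
@[simp] lemma shift_symm_single (k : ℤ) (a : ℂ) :
    shift.symm (Finsupp.single k a) = Finsupp.single (k - 1) a := by
  rw [LinearEquiv.symm_apply_eq, shift_single, sub_add_cancel]

/-- Coordinates of a shifted vector. [folklore] -/
@[simp] lemma shift_apply_apply (x : V) (k : ℤ) : shift x k = x (k - 1) := by
  induction x using Finsupp.induction_linear with
  | zero => simp
  | add x y hx hy => simp [hx, hy]
  | single j b =>
    rw [shift_single, Finsupp.single_apply, Finsupp.single_apply]
    by_cases h : j + 1 = k
    · rw [if_pos h, if_pos (by omega)]
    · rw [if_neg h, if_neg (by omega)]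

/-- Coordinates of an inversely shifted vector. [folklore] -/
@[simp] lemma shift_symm_apply_apply (x : V) (k : ℤ) : shift.symm x k = x (k + 1) := by
  induction x using Finsupp.induction_linear with
  | zero => simp
  | add x y hx hy => simp [hx, hy]
  | single j b =>
    rw [shift_symm_single, Finsupp.single_apply, Finsupp.single_apply]
    by_cases h : j = k + 1
    · subst h; simp
    · rw [if_neg, if_neg h]; omega

/-- The shift preserves the Hermitian form. [folklore] -/
lemma form_shift (x y : V) : form (shift x) (shift y) = form x y := by
  induction x using Finsupp.induction_linear with
  | zero => simp
  | add x₁ x₂ h₁ h₂ => rw [map_add, LinearMap.map_add₂, LinearMap.map_add₂, h₁, h₂]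
  | single k a => rw [shift_single, form_single_left, form_single_left, shift_apply_apply,
      add_sub_cancel_right]

/-- `δ_k^* ∘ shift = δ_{k-1}^*`. [folklore] -/
lemma lapply_comp_shift (k : ℤ) :
    (Finsupp.lapply k : V →ₗ[ℂ] ℂ) ∘ₗ (shift : V →ₗ[ℂ] V) = Finsupp.lapply (k - 1) := by
  ext j
  simp only [LinearMap.coe_comp, LinearEquiv.coe_coe, Function.comp_apply, Finsupp.lsingle_apply,
    Finsupp.lapply_apply, shift_apply_apply]

/-- `δ_k^* ∘ shift⁻¹ = δ_{k+1}^*`. [folklore] -/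
lemma lapply_comp_shift_symm (k : ℤ) :
    (Finsupp.lapply k : V →ₗ[ℂ] ℂ) ∘ₗ (shift.symm : V →ₗ[ℂ] V) = Finsupp.lapply (k + 1) := by
  ext j
  simp only [LinearMap.coe_comp, LinearEquiv.coe_coe, Function.comp_apply, Finsupp.lsingle_apply,
    Finsupp.lapply_apply, shift_symm_apply_apply]

/-- `phi0 ∘ shift = 2 • phi0 + δ_{-1}^*`. [folklore] -/
lemma phi0_comp_shift :
    phi0 ∘ₗ (shift : V →ₗ[ℂ] V) = (2 : ℂ) • phi0 + Finsupp.lapply (-1) := by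
  ext k
  simp only [LinearMap.coe_comp, LinearEquiv.coe_coe, Function.comp_apply, Finsupp.lsingle_apply,
    shift_single, phi0_single, LinearMap.add_apply, LinearMap.smul_apply, smul_eq_mul,
    Finsupp.lapply_apply, Finsupp.single_apply]
  rcases lt_trichotomy k (-1) with hk | rfl | hk
  · rw [weight_of_neg (by omega), weight_of_neg (by omega), if_neg (by omega)]; ring
  · simp [weight]
  · rw [weight_add_one (by omega), if_neg (by omega)]; ring

/-- `phi0 ∘ shift⁻¹ = 2⁻¹ • phi0 - 2⁻¹ • δ_0^*`. [folklore] -/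
lemma phi0_comp_shift_symm :
    phi0 ∘ₗ (shift.symm : V →ₗ[ℂ] V) = (2⁻¹ : ℂ) • phi0 - (2⁻¹ : ℂ) • Finsupp.lapply 0 := by
  ext k
  simp only [LinearMap.coe_comp, LinearEquiv.coe_coe, Function.comp_apply, Finsupp.lsingle_apply,
    shift_symm_single, phi0_single, LinearMap.sub_apply, LinearMap.smul_apply, smul_eq_mul,
    Finsupp.lapply_apply, Finsupp.single_apply]
  rcases lt_trichotomy k 0 with hk | rfl | hk
  · rw [weight_of_neg (by omega), weight_of_neg hk, if_neg (by omega)]; ring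
  · simp [weight]
  · have := weight_add_one (k := k - 1) (by omega)
    rw [sub_add_cancel] at this
    rw [this, if_neg (by omega)]; ring

/-! ### The group `Gp` -/

/-- The group `Gp`: `form`-unitary linear automorphisms `u` of `V = ℂ^(ℤ)` such that
precomposition with `u` and with `u⁻¹` preserves the space of linear forms `FF`. [folklore] -/
noncomputable def Gp : Subgroup (V ≃ₗ[ℂ] V) where
  carrier := {u | (∀ x y, form (u x) (u y) = form x y) ∧
    (∀ η ∈ FF, η ∘ₗ (u : V →ₗ[ℂ] V) ∈ FF) ∧ (∀ η ∈ FF, η ∘ₗ (u.symm : V →ₗ[ℂ] V) ∈ FF)}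
  mul_mem' {u v} hu hv := by
    refine ⟨fun x y => ?_, fun η hη => ?_, fun η hη => ?_⟩
    · rw [LinearEquiv.mul_apply, LinearEquiv.mul_apply, hu.1, hv.1]
    · have : η ∘ₗ ((u * v : V ≃ₗ[ℂ] V) : V →ₗ[ℂ] V) = (η ∘ₗ (u : V →ₗ[ℂ] V)) ∘ₗ (v : V →ₗ[ℂ] V) :=
        rfl
      rw [this]; exact hv.2.1 _ (hu.2.1 η hη)
    · have : η ∘ₗ ((u * v : V ≃ₗ[ℂ] V).symm : V →ₗ[ℂ] V) =
          (η ∘ₗ (v.symm : V →ₗ[ℂ] V)) ∘ₗ (u.symm : V →ₗ[ℂ] V) := rfl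
      rw [this]; exact hu.2.2 _ (hv.2.2 η hη)
  one_mem' := ⟨fun _ _ => rfl, fun η hη => hη, fun η hη => hη⟩
  inv_mem' {u} hu := by
    refine ⟨fun x y => ?_, fun η hη => hu.2.2 η hη, fun η hη => ?_⟩
    · rw [LinearEquiv.coe_inv, ← hu.1 (u.symm x) (u.symm y), LinearEquiv.apply_symm_apply,
        LinearEquiv.apply_symm_apply]
    · have : ((u⁻¹ : V ≃ₗ[ℂ] V).symm : V →ₗ[ℂ] V) = (u : V →ₗ[ℂ] V) := rfl
      rw [this]; exact hu.2.1 η hη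

/-- Elements of `Gp` are unitary for `form`. [folklore] -/
lemma form_apply_apply (u : Gp) (x y : V) : form ((u : V ≃ₗ[ℂ] V) x) ((u : V ≃ₗ[ℂ] V) y) =
    form x y := u.2.1 x y

/-- For `u ∈ Gp`, `phi0 ∘ u ∈ FF`. [folklore] -/
lemma phi0_comp_mem_FF (u : Gp) : phi0 ∘ₗ ((u : V ≃ₗ[ℂ] V) : V →ₗ[ℂ] V) ∈ FF :=
  u.2.2.1 _ phi0_mem_FF

/-- A linear automorphism preserving `form`, mapping `phi0` into `FF` both ways, and whose
coordinate forms transform into `FF`, belongs to `Gp` (membership test on the generators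
`phi0`, `δ_k^*` of `FF`). [folklore] -/
lemma mem_Gp_of {u : V ≃ₗ[ℂ] V} (h1 : ∀ x y, form (u x) (u y) = form x y)
    (h2 : phi0 ∘ₗ (u : V →ₗ[ℂ] V) ∈ FF)
    (h3 : ∀ k : ℤ, (Finsupp.lapply k : V →ₗ[ℂ] ℂ) ∘ₗ (u : V →ₗ[ℂ] V) ∈ FF)
    (h4 : phi0 ∘ₗ (u.symm : V →ₗ[ℂ] V) ∈ FF)
    (h5 : ∀ k : ℤ, (Finsupp.lapply k : V →ₗ[ℂ] ℂ) ∘ₗ (u.symm : V →ₗ[ℂ] V) ∈ FF) : u ∈ Gp := by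
  have key : ∀ w : V →ₗ[ℂ] V, phi0 ∘ₗ w ∈ FF →
      (∀ k : ℤ, (Finsupp.lapply k : V →ₗ[ℂ] ℂ) ∘ₗ w ∈ FF) → ∀ η ∈ FF, η ∘ₗ w ∈ FF := by
    intro w hw1 hw2 η hη
    have : FF ≤ FF.comap (LinearMap.lcomp ℂ ℂ w) := by
      refine sup_le ?_ ?_
      · rw [Submodule.span_le, Set.singleton_subset_iff]; exact hw1
      · rw [Submodule.span_le]; rintro _ ⟨k, rfl⟩; exact hw2 k
    exact this hη
  exact ⟨h1, key _ h2 h3, key _ h4 h5⟩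

/-- The shift belongs to `Gp`. [folklore] -/
lemma shift_mem_Gp : shift ∈ Gp := by
  refine mem_Gp_of form_shift ?_ (fun k => ?_) ?_ (fun k => ?_)
  · rw [phi0_comp_shift]
    exact FF.add_mem (FF.smul_mem _ phi0_mem_FF) (lapply_mem_FF _)
  · rw [lapply_comp_shift]; exact lapply_mem_FF _
  · rw [phi0_comp_shift_symm]
    exact FF.sub_mem (FF.smul_mem _ phi0_mem_FF) (FF.smul_mem _ (lapply_mem_FF _))
  · rw [lapply_comp_shift_symm]; exact lapply_mem_FF _

/-- Every unitary reflection belongs to `Gp` (`η ∘ refl m = η - c • ⟨m, ·⟩` and `⟨m, ·⟩ ∈ FF`).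
[folklore] -/
lemma reflEquiv_mem_Gp (m : V) (hm : form m m ≠ 0) : reflEquiv m hm ∈ Gp := by
  have hcomp : ∀ η ∈ FF, η ∘ₗ reflLin m ∈ FF := fun η hη => by
    rw [comp_reflLin]
    exact FF.sub_mem hη (FF.smul_mem _ (form_mem_FF m))
  have h1 : ((reflEquiv m hm : V ≃ₗ[ℂ] V) : V →ₗ[ℂ] V) = reflLin m := rfl
  have h2 : ((reflEquiv m hm).symm : V →ₗ[ℂ] V) = reflLin m := by
    ext x; simp
  refine ⟨fun x y => form_reflLin hm x y, fun η hη => ?_, fun η hη => ?_⟩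
  · rw [h1]; exact hcomp η hη
  · rw [h2]; exact hcomp η hη

/-- The shift as an element of `Gp`. [folklore] -/
noncomputable def shiftG : Gp := ⟨shift, shift_mem_Gp⟩

/-- `shiftG` acts as `shift`. [folklore] -/
@[simp] lemma coe_shiftG : ((shiftG : Gp) : V ≃ₗ[ℂ] V) = shift := rfl

/-- The reflection in `m` (`⟨m, m⟩ ≠ 0`) as an element of `Gp`. [folklore] -/
noncomputable def refl (m : V) (hm : form m m ≠ 0) : Gp := ⟨reflEquiv m hm, reflEquiv_mem_Gp m hm⟩

/-- `refl m hm` acts as `reflLin m`. [folklore] -/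
@[simp] lemma refl_apply (m : V) (hm : form m m ≠ 0) (x : V) :
    ((refl m hm : Gp) : V ≃ₗ[ℂ] V) x = reflLin m x := rfl

/-- For `u ∈ Gp` fixing `e k`, the `k`-th coordinate is `u`-invariant: `(u x) k = x k`
(`(u x) k = ⟨e k, u x⟩ = ⟨u (e k), u x⟩ = ⟨e k, x⟩`). [folklore] -/
lemma apply_apply_eq_of_fix (u : Gp) {k : ℤ} (hk : (u : V ≃ₗ[ℂ] V) (e k) = e k) (x : V) :
    (u : V ≃ₗ[ℂ] V) x k = x k := by
  have h := form_apply_apply u (e k) x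
  rw [hk, form_single_left, form_single_left] at h
  simpa using h

/-! ### The subgroups `U i` and the topology -/

/-- The subgroup `U i` of elements of `Gp` fixing `e k` for `|k| < i` and preserving `phi0`.
[folklore] -/
noncomputable def U (i : ℕ) : Subgroup Gp where
  carrier := {u | (∀ k : ℤ, k.natAbs < i → (u : V ≃ₗ[ℂ] V) (e k) = e k) ∧
    phi0 ∘ₗ ((u : V ≃ₗ[ℂ] V) : V →ₗ[ℂ] V) = phi0}
  mul_mem' {u v} hu hv := by
    refine ⟨fun k hk => ?_, ?_⟩
    · rw [Subgroup.coe_mul, LinearEquiv.mul_apply, hv.1 k hk, hu.1 k hk]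
    · have : phi0 ∘ₗ (((u * v : Gp) : V ≃ₗ[ℂ] V) : V →ₗ[ℂ] V) =
          (phi0 ∘ₗ ((u : V ≃ₗ[ℂ] V) : V →ₗ[ℂ] V)) ∘ₗ ((v : V ≃ₗ[ℂ] V) : V →ₗ[ℂ] V) := rfl
      rw [this, hu.2, hv.2]
  one_mem' := ⟨fun _ _ => rfl, rfl⟩
  inv_mem' {u} hu := by
    refine ⟨fun k hk => ?_, ?_⟩
    · rw [Subgroup.coe_inv, LinearEquiv.coe_inv, LinearEquiv.symm_apply_eq, hu.1 k hk]
    · refine LinearMap.ext fun x => ?_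
      have h := LinearMap.congr_fun hu.2 ((u : V ≃ₗ[ℂ] V).symm x)
      simp only [LinearMap.coe_comp, LinearEquiv.coe_coe, Function.comp_apply,
        LinearEquiv.apply_symm_apply] at h
      simp only [LinearMap.coe_comp, LinearEquiv.coe_coe, Function.comp_apply, Subgroup.coe_inv,
        LinearEquiv.coe_inv]
      exact h.symm

/-- Membership in `U i`. [folklore] -/
lemma mem_U {i : ℕ} {u : Gp} : u ∈ U i ↔ (∀ k : ℤ, k.natAbs < i → (u : V ≃ₗ[ℂ] V) (e k) = e k) ∧
    phi0 ∘ₗ ((u : V ≃ₗ[ℂ] V) : V →ₗ[ℂ] V) = phi0 := Iff.rfl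

/-- The subgroups `U i` decrease with `i`. [folklore] -/
lemma U_antitone : Antitone U := fun _ _ hij _ hu => ⟨fun k hk => hu.1 k (lt_of_lt_of_le hk hij), hu.2⟩

/-- An element of `U j` fixes every vector supported on `{k | |k| < j}`. [folklore] -/
lemma apply_eq_self_of_mem_U {j : ℕ} {u : Gp} (hu : u ∈ U j) {x : V}
    (hx : x ∈ Finsupp.supported ℂ ℂ {k : ℤ | k.natAbs < j}) : (u : V ≃ₗ[ℂ] V) x = x := by
  rw [Finsupp.supported_eq_span_single] at hx
  induction hx using Submodule.span_induction with
  | mem x hx =>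
    obtain ⟨k, hk, rfl⟩ := hx
    exact hu.1 k hk
  | zero => exact map_zero _
  | add x y _ _ hx hy => rw [map_add, hx, hy]
  | smul c x _ hx => rw [map_smul, hx]

/-- An element of `U j` preserves the coordinate forms `δ_k^*`, `|k| < j`. [folklore] -/
lemma apply_apply_eq_of_mem_U {j : ℕ} {u : Gp} (hu : u ∈ U j) {k : ℤ} (hk : k.natAbs < j)
    (x : V) : (u : V ≃ₗ[ℂ] V) x k = x k :=
  apply_apply_eq_of_fix u (hu.1 k hk) x

/-- An element of `U j` preserves every linear form `c • phi0 + ∑ₖ d k • δ_k^*` with `d`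
supported on `{k | |k| < j}`. [folklore] -/
lemma comp_eq_self_of_mem_U {j : ℕ} {u : Gp} (hu : u ∈ U j) (c : ℂ) {d : ℤ →₀ ℂ}
    (hd : ∀ k ∈ d.support, k.natAbs < j) (x : V) :
    (c • phi0 + d.sum fun k a => a • (Finsupp.lapply k : V →ₗ[ℂ] ℂ)) ((u : V ≃ₗ[ℂ] V) x) =
      (c • phi0 + d.sum fun k a => a • (Finsupp.lapply k : V →ₗ[ℂ] ℂ)) x := by
  have h0 : phi0 ((u : V ≃ₗ[ℂ] V) x) = phi0 x := LinearMap.congr_fun hu.2 x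
  simp only [LinearMap.add_apply, LinearMap.smul_apply, h0, Finsupp.sum, LinearMap.sum_apply,
    Finsupp.lapply_apply, smul_eq_mul]
  congr 1
  exact Finset.sum_congr rfl fun k hk => by rw [apply_apply_eq_of_mem_U hu (hd k hk)]

/-! ### The group filter basis and the topology -/

/-- The subgroups `U i` form a group filter basis on `Gp`: they are nested, and for `x₀ ∈ Gp` and
`i` there is `j` with `x₀ (U j) x₀⁻¹ ⊆ U i` — take `j` beyond the supports of the vectors
`x₀⁻¹ (e k)`, `|k| < i`, and of the finitely supported part of `phi0 ∘ x₀ ∈ FF`. [folklore] -/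
noncomputable instance basis : GroupFilterBasis Gp where
  sets := Set.range fun i : ℕ => ((U i : Subgroup Gp) : Set Gp)
  nonempty := ⟨_, 0, rfl⟩
  inter_sets := by
    rintro _ _ ⟨i, rfl⟩ ⟨j, rfl⟩
    exact ⟨_, ⟨max i j, rfl⟩, Set.subset_inter
      (SetLike.coe_subset_coe.2 (U_antitone (le_max_left i j)))
      (SetLike.coe_subset_coe.2 (U_antitone (le_max_right i j)))⟩
  one' := by
    rintro _ ⟨i, rfl⟩
    exact (U i).one_mem
  mul' := by
    rintro _ ⟨i, rfl⟩
    refine ⟨_, ⟨i, rfl⟩, ?_⟩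
    rintro _ ⟨a, ha, b, hb, rfl⟩
    exact (U i).mul_mem ha hb
  inv' := by
    rintro _ ⟨i, rfl⟩
    exact ⟨_, ⟨i, rfl⟩, fun u hu => (U i).inv_mem hu⟩
  conj' := by
    rintro x₀ _ ⟨i, rfl⟩
    classical
    obtain ⟨c, d, hcd⟩ := exists_of_mem_FF (phi0_comp_mem_FF x₀)
    -- all coordinates that must be frozen
    let T : Finset ℤ :=
      (Finset.Ioo (-(i : ℤ)) i).biUnion (fun k => ((x₀ : V ≃ₗ[ℂ] V).symm (e k)).support) ∪
        d.support
    let j : ℕ := T.sup Int.natAbs + 1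
    have hT : ∀ k ∈ T, k.natAbs < j := fun k hk =>
      Nat.lt_succ_of_le (Finset.le_sup (f := Int.natAbs) hk)
    refine ⟨_, ⟨j, rfl⟩, fun u hu => ?_⟩
    have hu : u ∈ U j := hu
    change x₀ * u * x₀⁻¹ ∈ U i
    refine ⟨fun k hk => ?_, ?_⟩
    · have hsupp : (x₀ : V ≃ₗ[ℂ] V).symm (e k) ∈
          Finsupp.supported ℂ ℂ {l : ℤ | l.natAbs < j} := by
        rw [Finsupp.mem_supported]
        intro l hl
        refine hT l (Finset.mem_union_left _ (Finset.mem_biUnion.2 ⟨k, ?_, hl⟩))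
        simp only [Finset.mem_Ioo]; omega
      change (x₀ : V ≃ₗ[ℂ] V) ((u : V ≃ₗ[ℂ] V) ((x₀ : V ≃ₗ[ℂ] V).symm (e k))) = e k
      rw [apply_eq_self_of_mem_U hu hsupp, LinearEquiv.apply_symm_apply]
    · refine LinearMap.ext fun x => ?_
      have hd : ∀ k ∈ d.support, k.natAbs < j := fun k hk => hT k (Finset.mem_union_right _ hk)
      have key := comp_eq_self_of_mem_U hu c hd ((x₀ : V ≃ₗ[ℂ] V).symm x)
      rw [← hcd] at key
      simp only [LinearMap.coe_comp, LinearEquiv.coe_coe, Function.comp_apply,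
        LinearEquiv.apply_symm_apply] at key
      exact key

/-- The group topology on `Gp` generated by the subgroups `U i`. [folklore] -/
noncomputable instance instTopologicalSpace : TopologicalSpace Gp := basis.topology

/-- `Gp` is a topological group. [folklore] -/
instance instIsTopologicalGroup : IsTopologicalGroup Gp := basis.isTopologicalGroup

/-- Each `U i` is a neighbourhood of `1`. [folklore] -/
lemma U_mem_nhds_one (i : ℕ) : ((U i : Subgroup Gp) : Set Gp) ∈ nhds (1 : Gp) :=
  basis.mem_nhds_one ⟨i, rfl⟩

/-- Each `U i` is open. [folklore] -/
lemma isOpen_U (i : ℕ) : IsOpen ((U i : Subgroup Gp) : Set Gp) :=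
  Subgroup.isOpen_of_mem_nhds _ (U_mem_nhds_one i)

/-- Every neighbourhood of `1` contains some `U i`. [folklore] -/
lemma exists_U_subset {s : Set Gp} (hs : s ∈ nhds (1 : Gp)) :
    ∃ i : ℕ, ((U i : Subgroup Gp) : Set Gp) ⊆ s := by
  obtain ⟨W, ⟨i, rfl⟩, hW⟩ := basis.nhds_one_hasBasis.mem_iff.1 hs
  exact ⟨i, hW⟩

/-- Every open subgroup of `Gp` contains some `U i`. [folklore] -/
lemma exists_U_le {H : Subgroup Gp} (hH : IsOpen (H : Set Gp)) : ∃ i : ℕ, U i ≤ H := by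
  obtain ⟨i, hi⟩ := exists_U_subset (hH.mem_nhds H.one_mem)
  exact ⟨i, fun u hu => hi hu⟩

/-- `Gp` is a nonarchimedean group: the open subgroups `U i` form a basis of neighbourhoods of
`1`. (It is Hausdorff but not locally compact; neither fact is needed.) [folklore] -/
instance instNonarchimedeanGroup : NonarchimedeanGroup Gp where
  is_nonarchimedean s hs := by
    obtain ⟨i, hi⟩ := exists_U_subset hs
    exact ⟨⟨U i, isOpen_U i⟩, hi⟩

/-! ### The tautological representation -/

/-- The tautological representation of `Gp` on `V = ℂ^(ℤ)`. [folklore] -/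
noncomputable def rho : Representation ℂ Gp V :=
  (LinearEquiv.automorphismGroup.toLinearMapMonoidHom (R := ℂ) (M := V)).comp Gp.subtype

/-- `rho u x = u x`. [folklore] -/
@[simp] lemma rho_apply (u : Gp) (x : V) : rho u x = (u : V ≃ₗ[ℂ] V) x := rfl

/-- The stabiliser of any vector contains some `U i` (take `i` beyond its support). [folklore] -/
lemma exists_U_le_stabilizer (x : V) : ∃ i : ℕ, U i ≤ rho.stabilizerSubgroup x := by
  refine ⟨x.support.sup Int.natAbs + 1, fun u hu => ?_⟩
  rw [Representation.mem_stabilizerSubgroup, rho_apply]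
  exact apply_eq_self_of_mem_U hu ((Finsupp.mem_supported ℂ x).2 fun k hk =>
    Nat.lt_succ_of_le (Finset.le_sup (f := Int.natAbs) (Finset.mem_coe.1 hk)))

/-- The tautological representation `rho` is smooth. [folklore] -/
theorem isSmooth_rho : rho.IsSmooth := fun x => by
  obtain ⟨i, hi⟩ := exists_U_le_stabilizer x
  exact Subgroup.isOpen_mono hi (isOpen_U i)

/-! ### Unitarizability -/

/-- The tautological representation is unitarizable: `form` is an invariant positive-definite
Hermitian form. [folklore] -/
theorem isUnitarizable_rho : rho.IsUnitarizable :=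
  ⟨form, ⟨fun x y => form_conj_symm x y⟩, fun _ hv => form_self_re_pos hv,
    fun g v w => form_apply_apply g v w⟩

/-! ### Special vectors and the reflections in them -/

/-- `⟨e k, e k⟩ = 1`. [folklore] -/
@[simp] lemma form_e_e (k : ℤ) : form (e k) (e k) = 1 := by simp

/-- `⟨e k, e k⟩ ≠ 0`. [folklore] -/
lemma form_e_e_ne_zero (k : ℤ) : form (e k) (e k) ≠ 0 := by rw [form_e_e]; exact one_ne_zero

/-- The vector `mvec k = e (k + 1) - 2 • e k`, orthogonal to `phi0` for `k ≥ 0`. [folklore] -/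
noncomputable def mvec (k : ℤ) : V := e (k + 1) - (2 : ℂ) • e k

/-- `⟨mvec k, x⟩ = x (k + 1) - 2 * x k`. [folklore] -/
lemma form_mvec (k : ℤ) (x : V) : form (mvec k) x = x (k + 1) - 2 * x k := by
  simp only [mvec, LinearMap.map_sub₂, LinearMap.map_smulₛₗ₂, form_single_left, map_one, one_mul,
    smul_eq_mul, map_ofNat]

/-- `⟨mvec k, mvec k⟩ = 5`. [folklore] -/
lemma form_mvec_self (k : ℤ) : form (mvec k) (mvec k) = 5 := by
  rw [form_mvec]
  simp [mvec]
  norm_num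

/-- `⟨mvec k, mvec k⟩ ≠ 0`. [folklore] -/
lemma form_mvec_self_ne_zero (k : ℤ) : form (mvec k) (mvec k) ≠ 0 := by
  rw [form_mvec_self]; norm_num

/-- `phi0 (mvec k) = 2 ^ (k + 1) - 2 · 2 ^ k = 0` for `k ≥ 0`. [folklore] -/
lemma phi0_mvec {k : ℤ} (hk : 0 ≤ k) : phi0 (mvec k) = 0 := by
  simp only [mvec, map_sub, map_smul, phi0_single, one_mul, smul_eq_mul, weight_add_one hk]
  ring

/-- Coordinates of `mvec k` vanish away from `k`, `k + 1`. [folklore] -/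
lemma mvec_apply_of_ne {k l : ℤ} (h1 : l ≠ k) (h2 : l ≠ k + 1) : mvec k l = 0 := by
  simp [mvec, Ne.symm h1, Ne.symm h2]

/-- A vector fixed by the reflection in `m` is orthogonal to `m`. [folklore] -/
lemma form_eq_zero_of_reflLin_eq {m x : V} (hm : form m m ≠ 0) (h : reflLin m x = x) :
    form m x = 0 := by
  rw [reflLin_apply, sub_eq_self, smul_eq_zero] at h
  rcases h with h | h
  · rcases mul_eq_zero.1 h with h | h
    · exact absurd h (div_ne_zero two_ne_zero hm)
    · exact h
  · exact absurd (show form m m = 0 by rw [h]; simp) hm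

/-- Membership test for reflections in `U i`: `refl m ∈ U i` as soon as `m` has no coordinate
`l` with `|l| < i` and `phi0 m = 0`. [folklore] -/
lemma refl_mem_U {m : V} (hm : form m m ≠ 0) {i : ℕ} (h1 : ∀ l : ℤ, l.natAbs < i → m l = 0)
    (h2 : phi0 m = 0) : refl m hm ∈ U i := by
  refine ⟨fun l hl => reflLin_of_form_eq_zero (by rw [form_single_right, h1 l hl, map_zero,
    zero_mul]), ?_⟩
  change phi0 ∘ₗ reflLin m = phi0
  rw [comp_reflLin, h2, mul_zero, zero_smul, sub_zero]

/-- The reflection in `e k`, `k ≤ -(i+1)`, lies in `U i`. [folklore] -/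
lemma refl_e_mem_U {i : ℕ} {k : ℤ} (hk : k + 1 ≤ -(i : ℤ)) : refl (e k) (form_e_e_ne_zero k) ∈ U i :=
  refl_mem_U _ (fun l hl => by rw [Finsupp.single_apply, if_neg (by omega)])
    (by rw [phi0_single, weight_of_neg (by omega), mul_zero])

/-- The reflection in `mvec k`, `k ≥ i`, lies in `U i`. [folklore] -/
lemma refl_mvec_mem_U {i : ℕ} {k : ℤ} (hk : (i : ℤ) ≤ k) :
    refl (mvec k) (form_mvec_self_ne_zero k) ∈ U i :=
  refl_mem_U _ (fun l hl => mvec_apply_of_ne (by omega) (by omega)) (phi0_mvec (by omega))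

/-! ### The centre acts by unitary scalars -/

/-- Every central element of `Gp` acts on `V` by a scalar of modulus one: commuting with the
reflection in `e (-1)` forces `z (e (-1)) = c • e (-1)`, commuting with the shift propagates this
to all `e k`, and unitarity gives `|c| = 1`. [folklore] -/
theorem exists_eq_smul_of_mem_center {z : Gp} (hz : z ∈ Subgroup.center Gp) :
    ∃ c : ℂ, ‖c‖ = 1 ∧ ∀ x : V, (z : V ≃ₗ[ℂ] V) x = c • x := by
  have hz' := Subgroup.mem_center_iff.1 hz
  set y : V := (z : V ≃ₗ[ℂ] V) (e (-1)) with hy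
  set c : ℂ := y (-1) with hc
  -- Step 1: `z (e (-1)) = c • e (-1)`
  have hP := congrArg (fun g : Gp => (g : V ≃ₗ[ℂ] V) (e (-1)))
    (hz' (refl (e (-1)) (form_e_e_ne_zero (-1))))
  simp only [Subgroup.coe_mul, LinearEquiv.mul_apply, refl_apply] at hP
  rw [reflLin_self (form_e_e_ne_zero (-1)), map_neg, ← hy, reflLin_apply, form_e_e,
    form_single_left, map_one, one_mul, ← hc, div_one] at hP
  -- hP : y - (2 * c) • e (-1) = -y
  have h2 : (2 : ℂ) • y = (2 * c) • e (-1) := by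
    have : y - (2 * c) • e (-1) + (y + (2 * c) • e (-1)) = -y + (y + (2 * c) • e (-1)) := by
      rw [hP]
    rw [two_smul]
    convert this using 1 <;> abel
  have h1 : y = c • e (-1) := by
    have := congrArg (fun w => (2 : ℂ)⁻¹ • w) h2
    simp only [smul_smul, inv_mul_cancel₀ (two_ne_zero (α := ℂ)), one_smul,
      inv_mul_cancel_left₀ (two_ne_zero (α := ℂ))] at this
    exact this
  -- Step 2: `z (e k) = c • e k` for all `k`, using commutation with the shift
  have hS : ∀ x : V, shift ((z : V ≃ₗ[ℂ] V) x) = (z : V ≃ₗ[ℂ] V) (shift x) := fun x => by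
    have := congrArg (fun g : Gp => (g : V ≃ₗ[ℂ] V) x) (hz' shiftG)
    simpa only [Subgroup.coe_mul, LinearEquiv.mul_apply, coe_shiftG] using this
  have hS' : ∀ x : V, shift.symm ((z : V ≃ₗ[ℂ] V) x) = (z : V ≃ₗ[ℂ] V) (shift.symm x) :=
    fun x => by
    rw [LinearEquiv.symm_apply_eq, hS, LinearEquiv.apply_symm_apply]
  have up : ∀ k : ℤ, (z : V ≃ₗ[ℂ] V) (e k) = c • e k →
      (z : V ≃ₗ[ℂ] V) (e (k + 1)) = c • e (k + 1) := fun k ih => by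
    have : e (k + 1) = shift (e k) := (shift_single k 1).symm
    rw [this, ← hS, ih, map_smul]
  have down : ∀ k : ℤ, (z : V ≃ₗ[ℂ] V) (e k) = c • e k →
      (z : V ≃ₗ[ℂ] V) (e (k - 1)) = c • e (k - 1) := fun k ih => by
    have : e (k - 1) = shift.symm (e k) := (shift_symm_single k 1).symm
    rw [this, ← hS', ih, map_smul]
  have hk : ∀ k : ℤ, (z : V ≃ₗ[ℂ] V) (e k) = c • e k := by
    intro k
    induction k using Int.induction_on with
    | zero =>
      have := up (-1) h1
      rwa [show (-1 : ℤ) + 1 = 0 by norm_num] at this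
    | succ i ih => exact up i ih
    | pred i ih => exact down (-(i : ℤ)) ih
  -- Step 3: linearity
  have hall : ∀ x : V, (z : V ≃ₗ[ℂ] V) x = c • x := by
    intro x
    induction x using Finsupp.induction_linear with
    | zero => simp
    | add x₁ x₂ h₁ h₂ => rw [map_add, smul_add, h₁, h₂]
    | single k a =>
      rw [← Finsupp.smul_single_one k a, map_smul, hk, smul_comm]
  -- Step 4: `|c| = 1` by unitarity
  refine ⟨c, ?_, hall⟩
  have hu := form_apply_apply z (e (-1)) (e (-1))
  rw [← hy, h1, LinearMap.map_smulₛₗ₂, map_smul, smul_eq_mul, smul_eq_mul, form_e_e,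
    mul_one] at hu
  have h3 : ((‖c‖ : ℝ) : ℂ) ^ 2 = 1 := by rw [← Complex.conj_mul', hu]
  have h4 : ‖c‖ ^ 2 = 1 := by exact_mod_cast h3
  exact (pow_eq_one_iff_of_nonneg (norm_nonneg c) two_ne_zero).1 h4

/-! ### Admissibility -/

/-- A vector fixed by `U j` is supported on `[-j, j)`: it is orthogonal to `e k` for `k < -j`
(reflection in `e k`) and satisfies `x (k+1) = 2 x k` for `k ≥ j` (reflection in `mvec k`),
which for a finitely supported `x` forces `x k = 0` for `k ≥ j`. [folklore] -/
lemma support_subset_of_fixed {j : ℕ} {x : V} (hfix : ∀ u ∈ U j, (u : V ≃ₗ[ℂ] V) x = x) :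
    ↑x.support ⊆ Set.Ico (-(j : ℤ)) j := by
  -- negative side
  have hneg : ∀ k : ℤ, k + 1 ≤ -(j : ℤ) → x k = 0 := fun k hk => by
    have h := form_eq_zero_of_reflLin_eq (form_e_e_ne_zero k) (hfix _ (refl_e_mem_U hk))
    rwa [form_single_left, map_one, one_mul] at h
  -- positive side: the recursion
  have hrec : ∀ k : ℤ, (j : ℤ) ≤ k → x (k + 1) = 2 * x k := fun k hk => by
    have h := form_eq_zero_of_reflLin_eq (form_mvec_self_ne_zero k) (hfix _ (refl_mvec_mem_U hk))
    rw [form_mvec] at h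
    exact sub_eq_zero.1 h
  obtain ⟨B, hB⟩ := x.support.bddAbove
  have hpos' : ∀ n : ℕ, ∀ k : ℤ, (j : ℤ) ≤ k → B < k + n → x k = 0 := by
    intro n
    induction n with
    | zero =>
      intro k _ hBk
      rw [Nat.cast_zero, add_zero] at hBk
      by_contra h
      exact not_le.2 hBk (hB (Finset.mem_coe.2 (Finsupp.mem_support_iff.2 h)))
    | succ n ih =>
      intro k hk hBk
      have h1 : x (k + 1) = 0 := ih (k + 1) (by omega) (by push_cast at hBk ⊢; linarith)
      have h2 := hrec k hk
      rw [h1] at h2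
      exact (mul_eq_zero.1 h2.symm).resolve_left two_ne_zero
  have hpos : ∀ k : ℤ, (j : ℤ) ≤ k → x k = 0 := fun k hk =>
    hpos' ((B - k).toNat + 1) k hk (by have := Int.self_le_toNat (B - k); push_cast; omega)
  intro k hk
  have hk' : x k ≠ 0 := Finsupp.mem_support_iff.1 (Finset.mem_coe.1 hk)
  refine ⟨?_, ?_⟩
  · by_contra h
    exact hk' (hneg k (by omega))
  · by_contra h
    exact hk' (hpos k (by omega))

/-- For every open subgroup `H` of `Gp` the space of `H`-fixed vectors is finite-dimensional (it
consists of vectors supported on `[-j, j)` where `U j ⊆ H`). In particular the tautological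
representation is admissible — genuinely, although `Gp` has no compact open subgroup. [folklore] -/
theorem finite_fixedPoints_of_isOpen {H : Subgroup Gp} (hH : IsOpen (H : Set Gp)) :
    Module.Finite ℂ (rho.fixedPoints H) := by
  obtain ⟨j, hj⟩ := exists_U_le hH
  have hle : rho.fixedPoints H ≤ Finsupp.supported ℂ ℂ (Set.Ico (-(j : ℤ)) j) := by
    intro x hx
    rw [Representation.mem_fixedPoints] at hx
    exact (Finsupp.mem_supported ℂ x).2
      (support_subset_of_fixed fun u hu => hx u (hj hu))
  haveI : Finite (Set.Ico (-(j : ℤ)) j) := (Set.finite_Ico _ _).to_subtype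
  haveI : Module.Finite ℂ (Finsupp.supported ℂ ℂ (Set.Ico (-(j : ℤ)) j)) :=
    Module.Finite.equiv
      (Finsupp.supportedEquivFinsupp (M := ℂ) (R := ℂ) (Set.Ico (-(j : ℤ)) j)).symm
  exact Submodule.finiteDimensional_of_le hle

/-- The tautological representation `rho` is admissible. [folklore] -/
theorem isAdmissible_rho : rho.IsAdmissible :=
  ⟨isSmooth_rho, fun K _ => finite_fixedPoints_of_isOpen K.isOpen⟩

/-! ### The smooth contragredient: exponential growth along the shift -/

/-- A smooth linear form is invariant under some `U j`. [folklore] -/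
lemma exists_U_invariant {φ : Module.Dual ℂ V} (hφ : φ ∈ rho.contragredient) :
    ∃ j : ℕ, ∀ u ∈ U j, φ ∘ₗ ((u : V ≃ₗ[ℂ] V) : V →ₗ[ℂ] V) = φ := by
  have hopen : IsOpen ((rho.dual.stabilizerSubgroup φ : Subgroup Gp) : Set Gp) := hφ
  obtain ⟨j, hj⟩ := exists_U_le hopen
  refine ⟨j, fun u hu => ?_⟩
  have h := hj ((U j).inv_mem hu)
  rw [Representation.mem_stabilizerSubgroup, Representation.dual_apply, inv_inv,
    Module.Dual.transpose_apply] at h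
  exact h

/-- `phi0` is a smooth linear form: its stabiliser contains `U 0`. [folklore] -/
lemma phi0_mem_contragredient : phi0 ∈ rho.contragredient := by
  have hle : U 0 ≤ rho.dual.stabilizerSubgroup phi0 := fun u hu => by
    rw [Representation.mem_stabilizerSubgroup, Representation.dual_apply,
      Module.Dual.transpose_apply]
    exact ((U 0).inv_mem hu).2
  exact Subgroup.isOpen_mono hle (isOpen_U 0)

/-- A `U j`-invariant linear form satisfies `φ (e (k+1)) = 2 φ (e k)` for `k ≥ j` (it kills
`mvec k`, being invariant under the reflection in it). [folklore] -/
lemma apply_e_succ {φ : Module.Dual ℂ V} {j : ℕ}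
    (hφ : ∀ u ∈ U j, φ ∘ₗ ((u : V ≃ₗ[ℂ] V) : V →ₗ[ℂ] V) = φ) {k : ℤ} (hk : (j : ℤ) ≤ k) :
    φ (e (k + 1)) = 2 * φ (e k) := by
  have h := LinearMap.congr_fun (hφ _ (refl_mvec_mem_U hk)) (mvec k)
  simp only [LinearMap.coe_comp, LinearEquiv.coe_coe, Function.comp_apply, refl_apply] at h
  rw [reflLin_self (form_mvec_self_ne_zero k), map_neg] at h
  have h0 : φ (mvec k) = 0 := by linear_combination (-(1 : ℂ) / 2) * h
  rw [mvec, map_sub, map_smul, smul_eq_mul] at h0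
  exact (sub_eq_zero.1 h0)

/-- A `U j`-invariant linear form doubles under the shift on vectors supported on `[j, ∞)`.
[folklore] -/
lemma apply_shift_of_mem_supported {φ : Module.Dual ℂ V} {j : ℕ}
    (hφ : ∀ u ∈ U j, φ ∘ₗ ((u : V ≃ₗ[ℂ] V) : V →ₗ[ℂ] V) = φ) {x : V}
    (hx : x ∈ Finsupp.supported ℂ ℂ {k : ℤ | (j : ℤ) ≤ k}) : φ (shift x) = 2 * φ x := by
  rw [Finsupp.supported_eq_span_single] at hx
  induction hx using Submodule.span_induction with
  | mem x hx =>
    obtain ⟨k, hk, rfl⟩ := hx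
    rw [shift_single]
    exact apply_e_succ hφ hk
  | zero => simp
  | add x y _ _ hx hy => rw [map_add, map_add, map_add, hx, hy, mul_add]
  | smul c x _ hx => rw [map_smul, map_smul, map_smul, hx, smul_eq_mul, smul_eq_mul, mul_left_comm]

/-- The shift moves supports up by one. [folklore] -/
lemma shift_mem_supported {b : ℤ} {x : V} (hx : x ∈ Finsupp.supported ℂ ℂ {k : ℤ | b ≤ k}) :
    shift x ∈ Finsupp.supported ℂ ℂ {k : ℤ | b + 1 ≤ k} := by
  rw [Finsupp.mem_supported'] at hx ⊢
  intro k hk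
  rw [shift_apply_apply]
  exact hx _ (fun h => hk (by simp only [Set.mem_setOf_eq] at h ⊢; omega))

/-- Iterated shifts move supports up. [folklore] -/
lemma iterate_shift_mem_supported {b : ℤ} {x : V}
    (hx : x ∈ Finsupp.supported ℂ ℂ {k : ℤ | b ≤ k}) (n : ℕ) :
    shift^[n] x ∈ Finsupp.supported ℂ ℂ {k : ℤ | b + n ≤ k} := by
  induction n with
  | zero => simpa using hx
  | succ n ih =>
    rw [Function.iterate_succ_apply']
    have := shift_mem_supported ih
    push_cast
    rwa [← add_assoc]

/-- Iterated shifts of basis vectors. [folklore] -/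
lemma iterate_shift_single (n : ℕ) (k : ℤ) (a : ℂ) :
    shift^[n] (Finsupp.single k a) = Finsupp.single (k + n) a := by
  induction n with
  | zero => simp
  | succ n ih =>
    rw [Function.iterate_succ_apply', ih, shift_single]
    push_cast
    rw [add_assoc]

/-- A `U j`-invariant linear form grows exactly like `2 ^ n` along the shift on vectors
supported on `[j, ∞)`. [folklore] -/
lemma apply_iterate_shift {φ : Module.Dual ℂ V} {j : ℕ}
    (hφ : ∀ u ∈ U j, φ ∘ₗ ((u : V ≃ₗ[ℂ] V) : V →ₗ[ℂ] V) = φ) {x : V}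
    (hx : x ∈ Finsupp.supported ℂ ℂ {k : ℤ | (j : ℤ) ≤ k}) (n : ℕ) :
    φ (shift^[n] x) = 2 ^ n * φ x := by
  induction n with
  | zero => simp
  | succ n ih =>
    have hn : shift^[n] x ∈ Finsupp.supported ℂ ℂ {k : ℤ | (j : ℤ) ≤ k} :=
      Finsupp.supported_mono (fun k (hk : (j : ℤ) + n ≤ k) => show (j : ℤ) ≤ k by omega)
        (iterate_shift_mem_supported hx n)
    rw [Function.iterate_succ_apply', apply_shift_of_mem_supported hφ hn, ih, pow_succ]
    ring

/-- **Uniform exponential growth of smooth matrix coefficients.** For every smooth linear form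
`φ` and every `v ∈ V` there is `A ≥ 0` with `‖φ (shift^n v)‖ ≤ 2 ^ n A` for all `n`; for
`φ = phi0`, `v = e 0` one has equality with `A = 1` (`phi0 (e n) = 2 ^ n`). [folklore] -/
theorem exists_norm_apply_iterate_shift_le {φ : Module.Dual ℂ V} (hφ : φ ∈ rho.contragredient)
    (v : V) : ∃ A : ℝ, 0 ≤ A ∧ ∀ n : ℕ, ‖φ (shift^[n] v)‖ ≤ 2 ^ n * A := by
  obtain ⟨j, hj⟩ := exists_U_invariant hφ
  obtain ⟨b, hb⟩ := v.support.bddBelow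
  have hv : v ∈ Finsupp.supported ℂ ℂ {k : ℤ | b ≤ k} :=
    (Finsupp.mem_supported ℂ v).2 fun k hk => hb hk
  set n₀ : ℕ := ((j : ℤ) - b).toNat with hn₀
  have hx : shift^[n₀] v ∈ Finsupp.supported ℂ ℂ {k : ℤ | (j : ℤ) ≤ k} :=
    Finsupp.supported_mono (fun k (hk : b + n₀ ≤ k) => show (j : ℤ) ≤ k by
      have := Int.self_le_toNat ((j : ℤ) - b); omega) (iterate_shift_mem_supported hv n₀)
  set S : ℝ := ∑ n ∈ Finset.range n₀, ‖φ (shift^[n] v)‖ with hS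
  have hS0 : 0 ≤ S := Finset.sum_nonneg fun _ _ => norm_nonneg _
  refine ⟨‖φ (shift^[n₀] v)‖ + S, by positivity, fun n => ?_⟩
  rcases le_or_gt n₀ n with h | h
  · obtain ⟨d, rfl⟩ := Nat.exists_eq_add_of_le h
    rw [add_comm n₀ d, Function.iterate_add_apply, apply_iterate_shift hj hx d, norm_mul,
      norm_pow, Complex.norm_ofNat]
    calc (2 : ℝ) ^ d * ‖φ (shift^[n₀] v)‖ ≤ 2 ^ (d + n₀) * ‖φ (shift^[n₀] v)‖ :=
          mul_le_mul_of_nonneg_right (pow_le_pow_right₀ one_le_two (Nat.le_add_right d n₀))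
            (norm_nonneg _)
      _ ≤ 2 ^ (d + n₀) * (‖φ (shift^[n₀] v)‖ + S) := by gcongr; exact le_add_of_nonneg_right hS0
  · have h1 : ‖φ (shift^[n] v)‖ ≤ S :=
      Finset.single_le_sum (f := fun n => ‖φ (shift^[n] v)‖) (fun _ _ => norm_nonneg _)
        (Finset.mem_range.2 h)
    calc ‖φ (shift^[n] v)‖ ≤ S := h1
      _ ≤ ‖φ (shift^[n₀] v)‖ + S := le_add_of_nonneg_left (norm_nonneg _)
      _ ≤ 2 ^ n * (‖φ (shift^[n₀] v)‖ + S) :=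
          le_mul_of_one_le_left (by positivity) (one_le_pow₀ one_le_two)

/-- Absolute values of matrix coefficients are constant on cosets of the centre: replacing `g` by
the chosen representative of `g Z(Gp)` does not change `‖φ (g v)‖` (the centre acts by unitary
scalars, `exists_eq_smul_of_mem_center`). [folklore] -/
lemma norm_apply_out (φ : Module.Dual ℂ V) (v : V) (g : Gp) :
    ‖φ (rho (Quotient.out (QuotientGroup.mk g : Gp ⧸ Subgroup.center Gp)) v)‖ =
      ‖φ (rho g v)‖ := by
  obtain ⟨z, hz⟩ := QuotientGroup.mk_out_eq_mul (Subgroup.center Gp) g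
  obtain ⟨c, hc, hcz⟩ := exists_eq_smul_of_mem_center z.2
  rw [hz, map_mul, Module.End.mul_apply, rho_apply, rho_apply, hcz, map_smul, map_smul,
    norm_smul, hc, one_mul]
  rfl

/-! ### The measure on `Gp ⧸ Z(Gp)` and the refutation -/

/-- All subsets of `Gp` are declared measurable. [folklore] -/
instance instMeasurableSpace : MeasurableSpace Gp := ⊤

/-- All subsets of `Gp` are measurable. [folklore] -/
instance instDiscreteMeasurableSpace : DiscreteMeasurableSpace Gp := ⟨fun _ => trivial⟩

/-- All subsets of `Gp ⧸ Z(Gp)` are measurable (for the quotient σ-algebra). [folklore] -/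
instance instDiscreteMeasurableSpaceQuotient :
    DiscreteMeasurableSpace (Gp ⧸ Subgroup.center Gp) :=
  ⟨fun _ => measurableSet_quotient.2 (MeasurableSet.of_discrete)⟩

/-- The measure `μ = ∑ₙ 8⁻ⁿ δ_{shift^n Z(Gp)}` on `Gp ⧸ Z(Gp)`. [folklore] -/
noncomputable def mu : MeasureTheory.Measure (Gp ⧸ Subgroup.center Gp) :=
  MeasureTheory.Measure.sum fun n : ℕ => ENNReal.ofReal ((8 : ℝ)⁻¹ ^ n) •
    MeasureTheory.Measure.dirac (QuotientGroup.mk (shiftG ^ n))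

/-- Integration against `mu`. [folklore] -/
lemma lintegral_mu (F : Gp ⧸ Subgroup.center Gp → ENNReal) :
    ∫⁻ x, F x ∂mu = ∑' n : ℕ, ENNReal.ofReal ((8 : ℝ)⁻¹ ^ n) *
      F (QuotientGroup.mk (shiftG ^ n)) := by
  rw [mu, MeasureTheory.lintegral_sum_measure]
  refine tsum_congr fun n => ?_
  rw [MeasureTheory.lintegral_smul_measure, MeasureTheory.lintegral_dirac, smul_eq_mul]

/-- Matrix coefficients along the powers of the shift. [folklore] -/
lemma rho_shiftG_pow (n : ℕ) (v : V) : rho (shiftG ^ n) v = shift^[n] v := by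
  rw [rho_apply, Subgroup.coe_pow, coe_shiftG, LinearEquiv.pow_apply]

/-- `2⁻ⁿ 2ⁿ = 1` in `ℝ`. [folklore] -/
lemma inv_two_pow_mul_two_pow (n : ℕ) : (2 : ℝ)⁻¹ ^ n * 2 ^ n = 1 := by
  rw [← mul_pow]; norm_num

/-- `8⁻ⁿ = (2⁻ⁿ)³` in `ℝ`. [folklore] -/
lemma inv_eight_pow (n : ℕ) : (8 : ℝ)⁻¹ ^ n = 2⁻¹ ^ n * (2⁻¹ ^ n * 2⁻¹ ^ n) := by
  rw [← mul_pow, ← mul_pow]; norm_num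

/-- A numerical identity: `8⁻ⁿ (2ⁿ A)² = 2⁻ⁿ A²`. [folklore] -/
lemma weights_identity (n : ℕ) (A : ℝ) : (8 : ℝ)⁻¹ ^ n * (2 ^ n * A) ^ 2 = 2⁻¹ ^ n * A ^ 2 := by
  calc (8 : ℝ)⁻¹ ^ n * (2 ^ n * A) ^ 2
      = 2⁻¹ ^ n * A ^ 2 * ((2⁻¹ ^ n * 2 ^ n) * (2⁻¹ ^ n * 2 ^ n)) := by rw [inv_eight_pow]; ring
    _ = 2⁻¹ ^ n * A ^ 2 := by rw [inv_two_pow_mul_two_pow, mul_one, mul_one]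

/-- A numerical identity: `8⁻ⁿ (2ⁿ)⁴ = 2ⁿ`. [folklore] -/
lemma weights_identity' (n : ℕ) : (8 : ℝ)⁻¹ ^ n * (2 ^ n) ^ 4 = 2 ^ n := by
  calc (8 : ℝ)⁻¹ ^ n * (2 ^ n) ^ 4
      = 2 ^ n * ((2⁻¹ ^ n * 2 ^ n) * (2⁻¹ ^ n * 2 ^ n) * (2⁻¹ ^ n * 2 ^ n)) := by
        rw [inv_eight_pow]; ring
    _ = 2 ^ n := by rw [inv_two_pow_mul_two_pow, mul_one, mul_one, mul_one]

/-- The tautological representation is square-integrable modulo the centre for `mu`, in the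
domination form: every smooth coefficient satisfies `‖φ (shift^n v)‖ ≤ 2ⁿ A`, and
`∑ₙ 8⁻ⁿ (2ⁿ A)² = 2 A² < ∞`. [folklore] -/
theorem isSquareIntegrableModCenter_rho : rho.IsSquareIntegrableModCenter mu := by
  intro φ hφ v
  obtain ⟨A, hA0, hA⟩ := exists_norm_apply_iterate_shift_le hφ v
  refine ⟨fun x => ‖φ (rho x.out v)‖, ⟨(Measurable.of_discrete).aestronglyMeasurable, ?_⟩,
    fun g => ?_⟩
  · rw [MeasureTheory.eLpNorm_lt_top_iff_lintegral_rpow_enorm_lt_top two_ne_zero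
      ENNReal.ofNat_ne_top, lintegral_mu, ENNReal.toReal_ofNat]
    have hterm : ∀ n : ℕ, ENNReal.ofReal ((8 : ℝ)⁻¹ ^ n) *
        ‖‖φ (rho (Quotient.out (QuotientGroup.mk (shiftG ^ n) : Gp ⧸ Subgroup.center Gp)) v)‖‖ₑ
          ^ (2 : ℝ) ≤ ENNReal.ofReal (2⁻¹ ^ n * A ^ 2) := fun n => by
      rw [norm_apply_out, rho_shiftG_pow, Real.enorm_eq_ofReal (norm_nonneg _),
        ENNReal.ofReal_rpow_of_nonneg (norm_nonneg _) zero_le_two, ← ENNReal.ofReal_mul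
        (pow_nonneg (by norm_num) n), ← weights_identity]
      refine ENNReal.ofReal_le_ofReal (mul_le_mul_of_nonneg_left ?_ (pow_nonneg (by norm_num) n))
      rw [Real.rpow_two]
      exact pow_le_pow_left₀ (norm_nonneg _) (hA n) 2
    have hsum : Summable fun n : ℕ => (2⁻¹ : ℝ) ^ n * A ^ 2 :=
      (summable_geometric_of_lt_one (by norm_num) (by norm_num)).mul_right _
    calc ∑' n : ℕ, ENNReal.ofReal ((8 : ℝ)⁻¹ ^ n) *
          ‖‖φ (rho (Quotient.out (QuotientGroup.mk (shiftG ^ n) : Gp ⧸ Subgroup.center Gp)) v)‖‖ₑ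
            ^ (2 : ℝ)
        ≤ ∑' n : ℕ, ENNReal.ofReal (2⁻¹ ^ n * A ^ 2) := ENNReal.tsum_le_tsum hterm
      _ = ENNReal.ofReal (∑' n : ℕ, (2⁻¹ : ℝ) ^ n * A ^ 2) :=
          (ENNReal.ofReal_tsum_of_nonneg (fun n => by positivity) hsum).symm
      _ < ⊤ := ENNReal.ofReal_lt_top
  · dsimp only
    rw [norm_apply_out]
    exact le_rfl

/-- The tautological representation is discrete series for `mu` (unitarizable and
square-integrable modulo the centre in the domination form). [folklore] -/
theorem isDiscreteSeries_rho : rho.IsDiscreteSeries mu :=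
  ⟨isUnitarizable_rho, isSquareIntegrableModCenter_rho⟩

/-- **The tautological representation is not tempered for `mu`**: the smooth coefficient
`n ↦ phi0 (shift^n (e 0)) = 2ⁿ` would have to be dominated by some `f ∈ L⁴(mu)` (`ε = 2`), but
`∫ f⁴ dmu ≥ ∑ₙ 8⁻ⁿ 16ⁿ = ∞`. [folklore] -/
theorem not_isTempered_rho : ¬ rho.IsTempered mu := by
  intro h
  obtain ⟨f, hf, hdom⟩ := h 2 two_pos phi0 phi0_mem_contragredient (e 0)
  have hlow : ∀ n : ℕ, (2 : ℝ) ^ n ≤ f (QuotientGroup.mk (shiftG ^ n)) := fun n => by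
    have := hdom (shiftG ^ n)
    rwa [Representation.matrixCoeff_apply, rho_shiftG_pow, iterate_shift_single, zero_add,
      phi0_single, one_mul, weight_natCast, norm_pow, Complex.norm_ofNat] at this
  have h4 : ENNReal.ofReal (2 + 2) = 4 := by norm_num
  have hfin := MeasureTheory.lintegral_rpow_enorm_lt_top_of_eLpNorm_lt_top (by norm_num)
    ENNReal.ofReal_ne_top hf.2
  rw [h4, ENNReal.toReal_ofNat, lintegral_mu] at hfin
  refine absurd hfin (not_lt.2 ?_)
  -- each term is at least `1`
  have hterm : ∀ n : ℕ, (1 : ENNReal) ≤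
      ENNReal.ofReal ((8 : ℝ)⁻¹ ^ n) * ‖f (QuotientGroup.mk (shiftG ^ n))‖ₑ ^ (4 : ℝ) := by
    intro n
    have h2n : (0 : ℝ) ≤ 2 ^ n := by positivity
    have hfn : ENNReal.ofReal (2 ^ n) ≤ ‖f (QuotientGroup.mk (shiftG ^ n))‖ₑ := by
      rw [Real.enorm_eq_ofReal_abs]
      exact ENNReal.ofReal_le_ofReal ((hlow n).trans (le_abs_self _))
    calc (1 : ENNReal) ≤ ENNReal.ofReal ((8 : ℝ)⁻¹ ^ n * (2 ^ n) ^ 4) :=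
          ENNReal.one_le_ofReal.2 (by rw [weights_identity']; exact one_le_pow₀ (by norm_num))
      _ = ENNReal.ofReal ((8 : ℝ)⁻¹ ^ n) * ENNReal.ofReal (2 ^ n) ^ (4 : ℝ) := by
          rw [ENNReal.ofReal_mul (pow_nonneg (by norm_num) n),
            ENNReal.ofReal_rpow_of_nonneg h2n (by norm_num), show (4 : ℝ) = (4 : ℕ) by norm_num,
            Real.rpow_natCast]
      _ ≤ ENNReal.ofReal ((8 : ℝ)⁻¹ ^ n) * ‖f (QuotientGroup.mk (shiftG ^ n))‖ₑ ^ (4 : ℝ) := by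
          gcongr
  calc (⊤ : ENNReal) = ∑' _ : ℕ, (1 : ENNReal) := (ENNReal.tsum_const_eq_top_of_ne_zero one_ne_zero).symm
    _ ≤ _ := ENNReal.tsum_le_tsum hterm

-- names the `@[deprecated]` record `Representation.IsDiscreteSeries.isTempered` of
-- `MatrixCoefficients.lean` on purpose: this IS its refutation (verdict clean-up 2026-08-15);
-- REMOVE-WHEN the record is deleted from `MatrixCoefficients.lean`
set_option linter.deprecated false in
/-- **Refutation of `Representation.IsDiscreteSeries.isTempered` as elaborated.** For the
nonarchimedean group `Gp` and `V = ℂ^(ℤ)`, the proposition fails: `rho` is admissible and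
discrete series for `mu`, but not tempered. (The refuted constant is deprecated and kept in
`MatrixCoefficients.lean` only so that this theorem can name it.) [folklore] -/
theorem not_isTempered_Gp :
    ¬ Representation.IsDiscreteSeries.isTempered (G := Gp) (V := V) := fun h =>
  not_isTempered_rho (h isAdmissible_rho isDiscreteSeries_rho)

end Literature.NumberTheory.Automorphic.TemperedCounterexample

-- names the `@[deprecated]` record `Representation.IsDiscreteSeries.isTempered` of
-- `MatrixCoefficients.lean` on purpose: this IS its refutation (verdict clean-up 2026-08-15);
-- REMOVE-WHEN the record is deleted from `MatrixCoefficients.lean`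
set_option linter.deprecated false in
/-- **`Representation.IsDiscreteSeries.isTempered` is false as stated** (its universal closure
over all nonarchimedean groups is refuted by the group
`Literature.NumberTheory.Automorphic.TemperedCounterexample.Gp`). The intended theorem, with the
local compactness of `G` among the hypotheses, is
`Representation.IsDiscreteSeries.isTempered_of_locallyCompactSpace`, proved in
`Literature.NumberTheory.Automorphic.MatrixCoefficientsTemperedProofs`; the refuted constant is
deprecated and kept only so that this theorem can name it. Declared deliberately in the Mathlib
namespace `Representation` (dot-notation extension, CONVENTIONS §2), next to the refuted constant
`Representation.IsDiscreteSeries.isTempered`. [folklore] -/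
theorem Representation.IsDiscreteSeries.not_forall_isTempered :
    ¬ ∀ (G V : Type) [Group G] [TopologicalSpace G] [NonarchimedeanGroup G] [AddCommGroup V]
      [Module ℂ V], Representation.IsDiscreteSeries.isTempered (G := G) (V := V) := fun h =>
  Literature.NumberTheory.Automorphic.TemperedCounterexample.not_isTempered_Gp
    (h Literature.NumberTheory.Automorphic.TemperedCounterexample.Gp
      Literature.NumberTheory.Automorphic.TemperedCounterexample.V)
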